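import Literature.MathematicalPhysics.QuantumFieldTheory.Balaban1983to89.B9DeltaALocalReadingsInCollarY
import Literature.MathematicalPhysics.QuantumFieldTheory.Balaban1983to89.B6ScalarChartV1

/-!
# `Balaban1983to89.B9LocalCubeGeometryOneLevelY` — [B9] p. 408 «□̃» ∕ [4] (2.1)–(2.4) p. 224 «Λ_j = Ω_j^{(j)} ∖ B^j(Ω_{j+1})»: THE CUBE GEOMETRY OF A ONE-LEVEL
# ENLARGED CUBE `□̃(c)` at node00-def-Y's W-a letters — `cubeDomY x c` is a union of member blocks and of level-`j` torus blocks which are `Λ_j`-sites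
# (the displayed cube hypotheses `hD`, `hDj`, `hDLam` of row 17's local centre number, DISCHARGED for one-level cubes)

T. Bałaban, *Propagators for lattice gauge theories in a background field*, Commun. Math. Phys. **99** (1985) 389–434 [Balaban1985BackgroundPropagators];
[4] = T. Bałaban, *Propagators and renormalization transformations for lattice gauge theories. II*, Commun. Math. Phys. **96** (1984) 223–250
[Balaban1984PropagatorsII].  Statement-level skeleton with citation tags; proofs where landed; nothing here is a claim about the Yang–Mills mass gap.

THE PRINT.  [B9] p. 408: *«Let us denote by □̃ a cube which is a sum of □ and the neighboring cubes from 𝒟»*; p. 239 of [4]: *«otherwise the operator G_□ is simply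
equal to the operator G_j on the torus»* (the cube meets blocks of one level only); [4] (2.3)–(2.4) p. 224 (the partition `𝔅 = ⋃ Λ_j`).

WHY THIS FILE (cell context, 2026-08-28).  Row 17's local centre number `m_□` at `U = 1` is a theorem (this seat, `Summits/…/BalabanUVNodesN06Row17LocalCentreOf
Lemma24Letter.coer_trIP_padDeltaALocY_one_of_cube_geometry`) modulo DISPLAYED cube geometry about the cube site set `D`: (`hD`) every member block `B^{j′}(y)`,
`y ∈ Λ_{j′}`, lies inside or outside `D`; (`hDj`) every level-`j` torus block lies inside or outside `D`; (`hDLam`) every level-`j` torus block inside `D` is a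
member block (`y ∈ Λ_j`).  THIS FILE DISCHARGES the three at W-a's `D := cubeDomY x c` (`= {z | blkOf z ∈ cubeBlksY x c}`, a union of member blocks BY DEFINITION)
for a ONE-LEVEL enlarged cube (`hone : ∀ z ∈ cubeDomY x c, lev z = j` — the enlarged cube `Q̃` of (2.36) meets blocks of levels `j(c)`, `j(c)+1` in general,
`B9DeltaALocalReadingsInCollarY.blkOf_level_le_of_mem_cubeDomY`; the one-level case is [4] p. 239's «G_□ = G_j»), through the chart dictionary of
`B6ScalarChartV1` (`blkOf_toBox_eq_iff`, `lamSite_domT_iff`, `exists_iterBlockOf_eq`):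
* ★ `cubeDomY_dichotomy_lamSite` (`hD`, every cube), ★ `cubeDomY_dichotomy_level` (`hDj`, one-level cubes), ★ `lamSite_of_block_subset_cubeDomY` (`hDLam`, one-level cubes).
The fourth hypothesis (`hNbr`: every level-`j` bond one of whose end blocks meets `D` is a member index bond — «non-deeper neighbours») is a property of the cube's
position in the member and stays displayed (false at the interface cubes of (2.89); ROAD «C» station C6).
HONEST SCOPE.  Finite bookkeeping through landed dictionaries; no estimate; NOT a node discharge; count-neutral; one finite 𝕋⁴ programme — nothing about the mass gap.
Cell `pub-ymgap` (D-0062), node N06 [B9] × N10 ROAD «C», seat `pub-ymgap-dag-n06-j` gen 24, 2026-08-28.  No `sorry`∕`axiom`∕`instance`∕`def`.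
-/

noncomputable section

namespace Literature.MathematicalPhysics.QuantumFieldTheory.Balaban1983to89.B9LocalCubeGeometryOneLevelY

open Literature.MathematicalPhysics.QuantumFieldTheory.Balaban1983to89
open Literature.MathematicalPhysics.QuantumFieldTheory.Balaban1983to89.Node00
open Literature.MathematicalPhysics.QuantumFieldTheory.Balaban1983to89.B6KLevelCensusIndexV1 (KIdx)
open Literature.MathematicalPhysics.QuantumFieldTheory.Balaban1983to89.B6GlobalChartV1 (PV boxEquiv toBox domT boxEquiv_apply)
open Literature.MathematicalPhysics.QuantumFieldTheory.Balaban1983to89.B6ScalarChartV1 (blkOf_toBox_eq_iff lamSite_domT_iff exists_iterBlockOf_eq)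
open Literature.MathematicalPhysics.QuantumFieldTheory.Balaban1983to89.B6Geom246MultiLevelBox (blkOf blkOf_val)
open Literature.MathematicalPhysics.QuantumFieldTheory.Balaban1983to89.B6Cover236MultiLevelBlocks (cubes)
open Literature.MathematicalPhysics.QuantumFieldTheory.Balaban1983to89.B9PinMembersKLevelV1 (MemberY)
open Literature.MathematicalPhysics.QuantumFieldTheory.Balaban1983to89.B9WalkLettersCoordsS (cubeDomY cubeBlksY)
open Literature.MathematicalPhysics.QuantumFieldTheory.Balaban1983to89.B9DeltaALocalReadingsInCollarY (mem_cubeDomY_iff_blkOf)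
open Literature.MathematicalPhysics.QuantumFieldTheory.Balaban1983to89.B5Eq118OneStroke (iterBlock iterBlockOf mem_iterBlock)
open Literature.MathematicalPhysics.QuantumFieldTheory.Balaban1983to89.Node00.OpsYNablaBridge (chartY chartY_eq)

variable {d ℓ : ℕ} {hd : 1 ≤ d + 1} {hL : Odd (ℓ + 1) ∧ 1 < ℓ + 1} {b₀ b₁ : ℝ} {Mstar : ℕ}
variable (x : MemberY d ℓ hd hL b₀ b₁ Mstar) (c : ↥(cubes x.toKIdx.D.toDomains))

/-- the chart of W-a ∕ def-Y IS the box chart `toBox`. [cite: Balaban1984PropagatorsII, (2.1) p.224, dictionary] -/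
theorem chartY_eq_toBox (y : Site (PV d ℓ x.m x.K hd hL) 0) : chartY x.toKIdx y = toBox x.toKIdx.hN y := rfl

/-- membership in `□̃(c)` depends only on the member block: two fine sites with the same block of `𝔅` are both in `cubeDomY x c` or both out.
[cite: Balaban1985BackgroundPropagators, p.408 («□̃ … a sum of □ and the neighboring cubes»), bookkeeping] -/
theorem mem_cubeDomY_iff_of_blkOf_eq {y y' : Site (PV d ℓ x.m x.K hd hL) 0}
    (h : blkOf x.toKIdx.D.toDomains (toBox x.toKIdx.hN y') = blkOf x.toKIdx.D.toDomains (toBox x.toKIdx.hN y)) :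
    chartY x.toKIdx y' ∈ cubeDomY x c ↔ chartY x.toKIdx y ∈ cubeDomY x c := by
  rw [chartY_eq_toBox, chartY_eq_toBox, mem_cubeDomY_iff_blkOf, mem_cubeDomY_iff_blkOf, h]

/-- ★ **`hD` AT `□̃(c)` (every cube)**: every member block `B^{j′}(y)`, `y ∈ Λ_{j′}`, lies inside `cubeDomY x c` or outside it — `□̃(c)` is a union of blocks of `𝔅`.
[cite: Balaban1985BackgroundPropagators, p.408; Balaban1984PropagatorsII, (2.3)–(2.4) p.224] -/
theorem cubeDomY_dichotomy_lamSite (j' : ℕ) (y : Site (PV d ℓ x.m x.K hd hL) j') (hy : (domT x.toKIdx.hN x.toKIdx.D x.toKIdx.hk).LamSite j' y) :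
    (∀ x' ∈ iterBlock j' y, chartY x.toKIdx x' ∈ cubeDomY x c) ∨ (∀ x' ∈ iterBlock j' y, chartY x.toKIdx x' ∉ cubeDomY x c) := by
  have hj' : j' ≤ x.m + x.K := ((domT x.toKIdx.hN x.toKIdx.D x.toKIdx.hk).le_of_lamSite hy).trans x.toKIdx.hk
  obtain ⟨x₀, hx₀⟩ := exists_iterBlockOf_eq (hd := hd) (hL := hL) hj' y
  have hlev : x.toKIdx.D.lev (toBox x.toKIdx.hN x₀ : Fin (d + 1) → ℤ) = j' := by
    rw [← lamSite_domT_iff x.toKIdx.hN x.toKIdx.D x.toKIdx.hk j' x₀, hx₀]; exact hy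
  have hsame : ∀ x' ∈ iterBlock j' y,
      blkOf x.toKIdx.D.toDomains (toBox x.toKIdx.hN x') = blkOf x.toKIdx.D.toDomains (toBox x.toKIdx.hN x₀) := by
    intro x' hx'
    rw [blkOf_toBox_eq_iff x.toKIdx.hN x.toKIdx.D x.toKIdx.hk x₀ x', hlev, (mem_iterBlock j' y x').1 hx', hx₀]
  by_cases h₀ : chartY x.toKIdx x₀ ∈ cubeDomY x c
  · exact Or.inl fun x' hx' => (mem_cubeDomY_iff_of_blkOf_eq x c (hsame x' hx')).2 h₀
  · exact Or.inr fun x' hx' h => h₀ ((mem_cubeDomY_iff_of_blkOf_eq x c (hsame x' hx')).1 h)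

/-- a fine site of a one-level `□̃(c)` has level `j`. [cite: Balaban1984PropagatorsII, p.239 («G_□ = G_j»), (2.3) p.224, bookkeeping] -/
theorem lev_eq_of_mem_cubeDomY {j : ℕ} (hone : ∀ z ∈ cubeDomY x c, x.toKIdx.D.lev z.1 = j) {y : Site (PV d ℓ x.m x.K hd hL) 0}
    (hy : chartY x.toKIdx y ∈ cubeDomY x c) : x.toKIdx.D.lev (toBox x.toKIdx.hN y : Fin (d + 1) → ℤ) = j := by
  rw [chartY_eq_toBox] at hy
  exact hone _ hy

/-- ★ **`hDj` AT A ONE-LEVEL `□̃(c)`**: every level-`j` torus block lies inside `cubeDomY x c` or outside it. [cite: Balaban1984PropagatorsII, p.239 («G_□ = G_j on the torus»), (2.1)–(2.4) p.224; Balaban1985BackgroundPropagators, p.408] -/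
theorem cubeDomY_dichotomy_level {j : ℕ} (hone : ∀ z ∈ cubeDomY x c, x.toKIdx.D.lev z.1 = j) (yk : Site (PV d ℓ x.m x.K hd hL) j) :
    (∀ x' ∈ iterBlock j yk, chartY x.toKIdx x' ∈ cubeDomY x c) ∨ (∀ x' ∈ iterBlock j yk, chartY x.toKIdx x' ∉ cubeDomY x c) := by
  by_cases h : ∃ x₁ ∈ iterBlock j yk, chartY x.toKIdx x₁ ∈ cubeDomY x c
  · obtain ⟨x₁, hx₁, hD₁⟩ := h
    have hlev : x.toKIdx.D.lev (toBox x.toKIdx.hN x₁ : Fin (d + 1) → ℤ) = j := lev_eq_of_mem_cubeDomY x c hone hD₁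
    refine Or.inl fun x' hx' => (mem_cubeDomY_iff_of_blkOf_eq x c ?_).2 hD₁
    rw [blkOf_toBox_eq_iff x.toKIdx.hN x.toKIdx.D x.toKIdx.hk x₁ x', hlev, (mem_iterBlock j yk x').1 hx', (mem_iterBlock j yk x₁).1 hx₁]
  · push Not at h
    exact Or.inr h

/-- ★ **`hDLam` AT A ONE-LEVEL `□̃(c)`**: a level-`j` torus block inside `cubeDomY x c` is a member block — its site lies in `Λ_j`.
[cite: Balaban1984PropagatorsII, (2.3)–(2.4) p.224 («Λ_j = Ω_j^{(j)} ∖ B^j(Ω_{j+1})»), p.239; Balaban1985BackgroundPropagators, p.408] -/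
theorem lamSite_of_block_subset_cubeDomY {j : ℕ} (hj : j ≤ x.m + x.K) (hone : ∀ z ∈ cubeDomY x c, x.toKIdx.D.lev z.1 = j)
    (yk : Site (PV d ℓ x.m x.K hd hL) j) (hin : ∀ x' ∈ iterBlock j yk, chartY x.toKIdx x' ∈ cubeDomY x c) :
    (domT x.toKIdx.hN x.toKIdx.D x.toKIdx.hk).LamSite j yk := by
  obtain ⟨x₁, hx₁⟩ := exists_iterBlockOf_eq (hd := hd) (hL := hL) hj yk
  have hmem : x₁ ∈ iterBlock j yk := (mem_iterBlock j yk x₁).2 hx₁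
  have hlev := lev_eq_of_mem_cubeDomY x c hone (hin x₁ hmem)
  rw [← hx₁]
  exact (lamSite_domT_iff x.toKIdx.hN x.toKIdx.D x.toKIdx.hk j x₁).2 hlev

end Literature.MathematicalPhysics.QuantumFieldTheory.Balaban1983to89.B9LocalCubeGeometryOneLevelY

end
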